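import Literature.AlgebraicTopology.SingularHomology.TorusCohomologyRingChange
import Literature.AlgebraicGeometry.HodgeTheory.RationalClassesRingChange
import Literature.AlgebraicGeometry.HodgeTheory.SupportedClassesRational
import HarnessLib

/-!
# The rational classes of `Hᵏ(Tⁿ; ℂ)` are the rational combinations of the cup monomials

Family `hodge`, layer `Literature/AlgebraicGeometry/HodgeTheory`. H. Lange, Ch. Birkenhake,
*Complex Abelian Varieties* (1992), §1.1.3 Lemma 1.1.17 / §1.1.4 Prop. 1.1.20 (the integral classes
of a complex torus are the integral span of the products of the coordinate classes; Hatcher 2002,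
Example 3.16 for `Tⁿ`). For the torus `Tⁿ = (ℝ/ℤ)ⁿ` (`Torus n`) and the cup-monomial basis
`ξ_s = ξ_{s₁} ⌣ ⋯ ⌣ ξ_{sₖ}` of `Hᵏ(Tⁿ; ℂ)` indexed by the `k`-subsets `s ⊆ Fin n`
(`torusMonomialBasis ℂ n k`, `Literature/AlgebraicTopology/SingularHomology/TorusCohomology`):

* `isRationalClass_torusMonomial` — every cup monomial is a rational class (`IsRationalClass`: it
  is `ι` of the same monomial over `ℚ`, `ι = ringChange (ℚ ↪ ℂ)`, and the generator `θ` is the class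
  of an integer-valued cochain);
* **`isRationalClass_iff_exists_eq_sum_ratCast_smul`** — a class `c ∈ Hᵏ(Tⁿ; ℂ)` is rational iff
  `c = Σ_s q_s ξ_s` with RATIONAL `q_s` (expand a `ℚ`-preimage in the `ℚ`-basis and apply `ι`);
* **`eq_of_sum_ratCast_smul_eq`** — the rational coefficients are unique (the `ξ_s` are
  `ℂ`-independent);
* `torusMonomialBasis_repr_mem_range_ratCast` — equivalently, the coordinates of a rational class in
  the cup-monomial basis are rational.

This is the `ℚ`-structure "`Hᵏ(T; ℚ) ⊗ ℂ = Hᵏ(T; ℂ)` with `Hᵏ(T; ℚ) = ⊕_s ℚ ξ_s`" in the form used by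
the Hodge-theoretic files (`IsRationalClass`, `IsRatBasisOn`-type statements). Everything is
proved; no named facts.

## References

* H. Lange, Ch. Birkenhake, *Complex Abelian Varieties*, Springer 1992, §1.1.3 Lemma 1.1.17,
  §1.1.4 Prop. 1.1.20. [LangeBirkenhake1992]
* A. Hatcher, *Algebraic Topology*, CUP 2002, §3.1 p. 198, Example 3.16. [HatcherAT2002]
-/

noncomputable section

open CategoryTheory
open Literature.AlgebraicTopology.SingularHomology

universe u

namespace Literature.AlgebraicGeometry.HodgeTheory

variable {n k : ℕ}

/-- **The cup monomials of `Tⁿ` are rational classes.** [cite: HatcherAT2002, §3.1 p. 198] -/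
theorem isRationalClass_torusMonomial (e : Fin k → Fin n) : IsRationalClass (torusMonomial ℂ n k e) := by
  rw [← ringChange_torusMonomial (algebraMap ℚ ℂ) n k e]
  exact isRationalClass_ringChange _

/-- A rational combination of cup monomials is a rational class. [cite: HatcherAT2002, §3.1 p. 198] -/
theorem isRationalClass_sum_ratCast_smul_torusMonomial (q : Set.powersetCard (Fin n) k → ℚ) :
    IsRationalClass (∑ s, ((q s : ℚ) : ℂ) • torusMonomial ℂ n k (subsetEmb s)) :=
  IsRationalClass.sum_smul _ (fun s => isRationalClass_torusMonomial (subsetEmb s)) q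

/-- **The rational classes of `Hᵏ(Tⁿ; ℂ)` are exactly the rational combinations of the cup
monomials** `ξ_s`, `s` a `k`-subset of `Fin n` (Lange–Birkenhake 1992, Lemma 1.1.17 /
Prop. 1.1.20 with `ℚ` in place of `ℤ`; Hatcher Example 3.16 over `ℚ`, transported by `ℚ ↪ ℂ`).
[cite: LangeBirkenhake1992, §1.1.3 Lemma 1.1.17] -/
theorem isRationalClass_iff_exists_eq_sum_ratCast_smul (c : singularCohomology ℂ ℂ (Torus n) k) :
    IsRationalClass c ↔
      ∃ q : Set.powersetCard (Fin n) k → ℚ, c = ∑ s, ((q s : ℚ) : ℂ) • torusMonomial ℂ n k (subsetEmb s) := by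
  constructor
  · intro hc
    obtain ⟨x, rfl⟩ := hc.exists_ringChange_eq
    refine ⟨fun s => (torusMonomialBasis ℚ n k).repr x s, ?_⟩
    conv_lhs => rw [← (torusMonomialBasis ℚ n k).sum_repr x]
    rw [ringChange_sum_smul]
    refine Finset.sum_congr rfl fun s _ => ?_
    rw [torusMonomialBasis_apply, ringChange_torusMonomial]
  · rintro ⟨q, rfl⟩
    exact isRationalClass_sum_ratCast_smul_torusMonomial q

/-- **Uniqueness of the rational coefficients** (the cup monomials are `ℂ`-linearly independent).
[cite: LangeBirkenhake1992, §1.1.4 Prop. 1.1.20] -/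
theorem eq_of_sum_ratCast_smul_eq {q q' : Set.powersetCard (Fin n) k → ℚ}
    (h : ∑ s, ((q s : ℚ) : ℂ) • torusMonomial ℂ n k (subsetEmb s) =
      ∑ s, ((q' s : ℚ) : ℂ) • torusMonomial ℂ n k (subsetEmb s)) : q = q' := by
  have hli := linearIndependent_torusMonomial ℂ n k
  have h0 : ∑ s, (((q s : ℚ) : ℂ) - ((q' s : ℚ) : ℂ)) • torusMonomial ℂ n k (subsetEmb s) = 0 := by
    simp only [sub_smul, Finset.sum_sub_distrib, h, sub_self]
  funext s
  have hs := Fintype.linearIndependent_iff.1 hli (fun s => ((q s : ℚ) : ℂ) - ((q' s : ℚ) : ℂ)) h0 s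
  exact_mod_cast sub_eq_zero.1 hs

/-- **The coordinates of a rational class in the cup-monomial basis are rational.**
[cite: LangeBirkenhake1992, §1.1.4 Prop. 1.1.20] -/
theorem torusMonomialBasis_repr_mem_range_ratCast {c : singularCohomology ℂ ℂ (Torus n) k}
    (hc : IsRationalClass c) (s : Set.powersetCard (Fin n) k) :
    (torusMonomialBasis ℂ n k).repr c s ∈ Set.range ((↑) : ℚ → ℂ) := by
  obtain ⟨q, rfl⟩ := (isRationalClass_iff_exists_eq_sum_ratCast_smul _).1 hc
  refine ⟨q s, ?_⟩
  have h : ∑ t, ((q t : ℚ) : ℂ) • torusMonomial ℂ n k (subsetEmb t) =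
      ∑ t, ((q t : ℚ) : ℂ) • torusMonomialBasis ℂ n k t := by
    simp only [torusMonomialBasis_apply]
  rw [h, (torusMonomialBasis ℂ n k).repr_sum_self]

end Literature.AlgebraicGeometry.HodgeTheory
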